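import Literature.AlgebraicGeometry.Resolution.FiniteNormalizationCompleteLocalBase
import Literature.AlgebraicGeometry.Resolution.LocalBlowup
import Mathlib.RingTheory.IntegralClosure.IsIntegralClosure.Basic
import Mathlib.RingTheory.Localization.FractionRing
import Mathlib.RingTheory.Valuation.ValuationSubring
import Mathlib.FieldTheory.IntermediateField.Adjoin.Basic
import HarnessLib

/-!
# Normal local models exist ([CoP1] §9: "Let `R₁` be a normal local model of `V/k` …"; Cossart–Piltant 2019, Def. 4.1)

Topic: `Literature/AlgebraicGeometry/Resolution`. PROOF side of `CossartPiltant2019ReductionP`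
(`ArithmeticalThreefoldsLocal.lean`), input (C4), decomposition layer of [CoP1] Prop. 9.3
(hypothesis `hDec` of `cossartPiltant2019ReductionP_of_cjs_of_stableInertiaHensel`). The printed
proof works with NORMAL local models ("By proposition 6.2, there exists a normal local model `R₀`
of `V/k` …", "Let `R₁` be a normal local model of `V/k` …", "Let `R̄` be the integral closure of
`R₁[{Fᵢ}, {Hⱼ}]` …", HAL pp. 27–28); Cossart–Piltant 2019, Def. 4.1 (arXiv v1 p. 54): "A normal
local model of `𝒪_v|S` is the localization `B_P` of a finitely generated `S`-algebra `B`,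
`S ⊆ B ⊆ 𝒪_v`, `QF(B) = K` such that `B` is normal … Note that `B′` is actually a normal local
model because `S`, hence `B`, is excellent." In the frame of this chain (models are
`S[t] ⊆ E` for finite `t`), their existence is the finiteness of normalization, available in the
tree for a COMPLETE Noetherian local base (`EGAIV2_7_7_4_finiteNormalization_completeLocal_holds`,
EGA IV₂ 7.7.4):

* `exists_adjoin_isIntegrallyClosedIn` — PROVED: for `S` complete Noetherian local mapped
  into a field `E`, a subfield `M ∋ S` generated over `S` by a finite `t₀`, there is a
  finite `t ⊇ t₀` in `M`, consisting of elements integral over `S[t₀]`, such that `S[t]` is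
  integrally closed in `M` (every element of `M` integral over `S[t]` lies in `S[t]`);
* `exists_normal_model` — PROVED, valuation form: if moreover `t₀ ⊆ O` for a valuation ring `O`
  of `E` containing `S`, then `S[t] ⊆ O` as well — a NORMAL MODEL of `O ∩ M` containing `t₀`.

Everything is PROVED; no named facts, definitions, instances or notation are introduced.

## Sources

* V. Cossart, O. Piltant, J. Algebra 320 (2008) 1051–1082: §9, proof of Prop. 9.3 (HAL
  hal-00139124, pp. 27–28). [CossartPiltant2008]
* V. Cossart, O. Piltant, J. Algebra 529 (2019) = arXiv:1412.0868, Def. 4.1 (arXiv v1 p. 54).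
  [CossartPiltant2019]
* A. Grothendieck, EGA IV₂ (7.7.4). [EGAIV2]
-/

noncomputable section

open IsLocalRing

namespace Literature.AlgebraicGeometry.Resolution

universe u

/-- Elements of the subfield generated by `S` and `t` are fractions of elements of `S[t]`.
[folklore] -/
private theorem exists_div_eq_of_mem_closure₀ {S Ω : Type u} [CommRing S] [Field Ω] [Algebra S Ω]
    (t : Set Ω) {z : Ω} (hz : z ∈ Subfield.closure (Set.range (algebraMap S Ω) ∪ t)) :
    ∃ a b : Ω, a ∈ Algebra.adjoin S t ∧ b ∈ Algebra.adjoin S t ∧ b ≠ 0 ∧ z = a / b := by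
  obtain ⟨y, hy, w, hw, hyw⟩ := Subfield.mem_closure_iff.mp hz
  rw [← Algebra.adjoin_eq_ring_closure] at hy hw
  by_cases hw0 : w = 0
  · refine ⟨0, 1, zero_mem _, one_mem _, one_ne_zero, ?_⟩
    rw [← hyw, hw0, div_zero, zero_div]
  · exact ⟨y, w, hy, hw, hw0, hyw.symm⟩

/-- **Normal models exist** (finiteness of normalization over a complete local base). Let `S` be
a complete Noetherian local ring mapped to a field `E`, `M` a subfield containing
`S` and generated over `S` by the finite set `t₀ ⊆ M`. Then there is a finite `t` with
`t₀ ⊆ t ⊆ M`, all of whose elements are integral over `S[t₀]`, such that `S[t]` is INTEGRALLY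
CLOSED IN `M`: every `x ∈ M` integral over `S[t]` lies in `S[t]` (the integral closure of
`S[t₀]` in `M = Frac S[t₀]` is a finite `S[t₀]`-module by EGA IV₂ 7.7.4, and `S[t]` is it).
[cite: CossartPiltant2019, Def. 4.1 (arXiv v1 p. 54) "normal local model"]
[cite: CossartPiltant2008, proof of Prop. 9.3 (HAL p. 27) "Let `R₁` be a normal local model"]
[cite: EGAIV2, Cor. (7.7.4)] -/
theorem exists_adjoin_isIntegrallyClosedIn (S : Type u) [CommRing S] [IsLocalRing S]
    [IsNoetherianRing S] [IsAdicComplete (maximalIdeal S) S]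
    (E : Type u) [Field E] [Algebra S E]
    (M : Subfield E) (hSM : ∀ s : S, algebraMap S E s ∈ M)
    (t₀ : Finset E) (ht₀M : (t₀ : Set E) ⊆ M)
    (hMcl : M ≤ Subfield.closure (Set.range (algebraMap S E) ∪ (t₀ : Set E))) :
    ∃ t : Finset E, (t₀ : Set E) ⊆ t ∧ (t : Set E) ⊆ M ∧
      (∀ x ∈ t, IsIntegral (Algebra.adjoin S (t₀ : Set E)) x) ∧
      ∀ x : E, x ∈ M → IsIntegral (Algebra.adjoin S (t : Set E)) x →
        x ∈ Algebra.adjoin S (t : Set E) := by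
  classical
  set B : Subalgebra S E := Algebra.adjoin S (t₀ : Set E) with hBdef
  -- `B ⊆ M`
  let MS : Subalgebra S E :=
    { M.toSubring with
      algebraMap_mem' := fun s => hSM s }
  have hBM : ∀ b : B, (b : E) ∈ M := fun b =>
    (Algebra.adjoin_le (S := MS) ht₀M : B ≤ MS) b.2
  -- `B` is a domain of finite type over `S`
  haveI : Algebra.FiniteType S B :=
    (Subalgebra.fg_iff_finiteType _).mp (Subalgebra.fg_adjoin_finset _)
  -- the field `K = M` as a `B`-algebra, a fraction field of `B`
  let K : Type u := M
  letI : Algebra B K := ((algebraMap B E).codRestrict M hBM).toAlgebra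
  haveI : IsScalarTower B K E := IsScalarTower.of_algebraMap_eq fun _ => rfl
  have hBinj : Function.Injective (algebraMap B K) := fun a b hab => by
    apply Subtype.ext
    have := congrArg (fun z : K => (z : E)) hab
    exact this
  haveI : FaithfulSMul B K := (faithfulSMul_iff_algebraMap_injective B K).mpr hBinj
  have hcoeK : ∀ b : B, ((algebraMap B K b : K) : E) = (b : E) := fun _ => rfl
  haveI : IsFractionRing B K := by
    refine IsFractionRing.of_field B K fun z => ?_
    obtain ⟨a, b, ha, hb, -, hzab⟩ := exists_div_eq_of_mem_closure₀ (t₀ : Set E) (hMcl z.2)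
    refine ⟨⟨a, ha⟩, ⟨b, hb⟩, Subtype.ext ?_⟩
    change (z : E) = (((algebraMap B K ⟨a, ha⟩ / algebraMap B K ⟨b, hb⟩ : K) : E))
    rw [Subfield.coe_div, hcoeK, hcoeK]
    exact hzab
  -- finiteness of the normalization (EGA IV₂ 7.7.4), transported to `K`
  have hfinF : Module.Finite B (integralClosure B (FractionRing B)) :=
    EGAIV2_7_7_4_finiteNormalization_completeLocal_holds S B inferInstance
  let e : FractionRing B ≃ₐ[B] K := FractionRing.algEquiv B K
  have hmap : (integralClosure B (FractionRing B)).map (e : FractionRing B →ₐ[B] K) =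
      integralClosure B K := integralClosure_map_algEquiv e
  have hfg0 : (Subalgebra.toSubmodule (integralClosure B (FractionRing B))).FG :=
    Module.Finite.iff_fg.mp hfinF
  have hfg : (Subalgebra.toSubmodule (integralClosure B K)).FG := by
    rw [← hmap, Subalgebra.map_toSubmodule]
    exact Submodule.FG.map _ hfg0
  obtain ⟨s, hs⟩ := hfg
  -- the new generators, read in `E`
  let s' : Finset E := s.image (fun z : K => (z : E))
  have hs'int : ∀ x ∈ s', IsIntegral B x := by
    intro x hx
    obtain ⟨z, hz, rfl⟩ := Finset.mem_image.mp hx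
    have hzC : z ∈ integralClosure B K := by
      have : z ∈ Subalgebra.toSubmodule (integralClosure B K) := by
        rw [← hs]; exact Submodule.subset_span hz
      exact this
    exact (mem_integralClosure_iff B K).mp hzC |>.map (IsScalarTower.toAlgHom B K E)
  have hBt : B ≤ Algebra.adjoin S ((t₀ ∪ s' : Finset E) : Set E) :=
    Algebra.adjoin_mono (by rw [Finset.coe_union]; exact Set.subset_union_left)
  refine ⟨t₀ ∪ s', by rw [Finset.coe_union]; exact Set.subset_union_left, ?_, ?_, ?_⟩
  · -- `t ⊆ M`
    intro x hx
    rw [Finset.coe_union] at hx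
    rcases hx with hx | hx
    · exact ht₀M hx
    · obtain ⟨z, -, rfl⟩ := Finset.mem_image.mp hx
      exact z.2
  · -- integrality over `S[t₀]`
    intro x hx
    rcases Finset.mem_union.mp hx with hx | hx
    · exact isIntegral_algebraMap (A := E) (R := B) (x := (⟨x, Algebra.subset_adjoin hx⟩ : B))
    · exact hs'int x hx
  · -- integral closedness in `M`
    intro x hxM hxint
    -- `S[t] = B[s']` is integral over `B`
    have hadj : Algebra.adjoin S ((t₀ ∪ s' : Finset E) : Set E) =
        (Algebra.adjoin B (s' : Set E)).restrictScalars S := by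
      rw [Finset.coe_union, Algebra.adjoin_union_eq_adjoin_adjoin]
    haveI hint : Algebra.IsIntegral B (Algebra.adjoin B (s' : Set E)) :=
      Algebra.IsIntegral.adjoin (fun x hx => hs'int x hx)
    -- `x` is integral over `B`: `S[t]` is integral over `B`
    set T : Subalgebra S E := Algebra.adjoin S ((t₀ ∪ s' : Finset E) : Set E) with hTdef
    letI : Algebra B T := (Subalgebra.inclusion hBt).toRingHom.toAlgebra
    haveI : IsScalarTower B T E := IsScalarTower.of_algebraMap_eq fun _ => rfl
    haveI : Algebra.IsIntegral B T := by
      refine ⟨fun y => ?_⟩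
      have hy : (y : E) ∈ Algebra.adjoin B (s' : Set E) := by
        have h2 : (y : E) ∈ (Algebra.adjoin B (s' : Set E)).restrictScalars S :=
          (le_of_eq hadj) y.2
        exact h2
      have h1 : IsIntegral B (y : E) :=
        (hint.isIntegral ⟨(y : E), hy⟩).map (Algebra.adjoin B (s' : Set E)).val
      exact (isIntegral_algHom_iff (IsScalarTower.toAlgHom B T E) Subtype.val_injective).mp h1
    have hxB : IsIntegral B x := isIntegral_trans x hxint
    -- hence `⟨x⟩ ∈ integralClosure B K = span s`
    have hxK : IsIntegral B (⟨x, hxM⟩ : K) :=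
      (isIntegral_algHom_iff (IsScalarTower.toAlgHom B K E) (fun a b h => Subtype.ext h)).mp hxB
    have hxspan : (⟨x, hxM⟩ : K) ∈ Submodule.span B (s : Set K) := by
      rw [hs]; exact hxK
    -- read the span in `E`
    have key : ∀ z : K, z ∈ Submodule.span B (s : Set K) →
        (z : E) ∈ Algebra.adjoin S ((t₀ ∪ s' : Finset E) : Set E) := by
      intro z hz
      refine Submodule.span_induction ?_ ?_ ?_ ?_ hz
      · intro w hw
        exact Algebra.subset_adjoin (by
          rw [Finset.coe_union]
          exact Or.inr (Finset.mem_coe.mpr (Finset.mem_image.mpr ⟨w, hw, rfl⟩)))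
      · exact zero_mem _
      · intro a b _ _ ha hb
        exact add_mem ha hb
      · intro b w _ hw
        change ((b : E) * (w : E)) ∈ _
        refine mul_mem ?_ hw
        exact Algebra.adjoin_mono (by rw [Finset.coe_union]; exact Set.subset_union_left) b.2
    exact key _ hxspan

/-- **A normal model inside the valuation ring.** In the situation of
`exists_adjoin_isIntegrallyClosedIn`, if `S` and `t₀` lie in a valuation ring `O` of `E`, then so
does `S[t]` (its generators are integral over `S[t₀] ⊆ O` and `O` is integrally closed): a
NORMAL MODEL `S[t] ⊆ O ∩ M` of `M` containing `t₀`.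
[cite: CossartPiltant2019, Def. 4.1 (arXiv v1 p. 54)] [cite: CossartPiltant2008, proof of Prop. 9.3 (HAL p. 27)] -/
theorem exists_normal_model (S : Type u) [CommRing S] [IsLocalRing S]
    [IsNoetherianRing S] [IsAdicComplete (maximalIdeal S) S]
    (E : Type u) [Field E] [Algebra S E]
    (OE : ValuationSubring E) (hSO : ∀ s : S, algebraMap S E s ∈ OE)
    (M : Subfield E) (hSM : ∀ s : S, algebraMap S E s ∈ M)
    (t₀ : Finset E) (ht₀M : (t₀ : Set E) ⊆ M) (ht₀O : ∀ x ∈ t₀, x ∈ OE)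
    (hMcl : M ≤ Subfield.closure (Set.range (algebraMap S E) ∪ (t₀ : Set E))) :
    ∃ t : Finset E, (t₀ : Set E) ⊆ t ∧ (t : Set E) ⊆ M ∧
      M ≤ Subfield.closure (Set.range (algebraMap S E) ∪ (t : Set E)) ∧
      (Algebra.adjoin S (t : Set E)).toSubring ≤ OE.toSubring ∧
      ∀ x : E, x ∈ M → IsIntegral (Algebra.adjoin S (t : Set E)) x →
        x ∈ Algebra.adjoin S (t : Set E) := by
  obtain ⟨t, ht₀t, htM, htint, hcl⟩ :=
    exists_adjoin_isIntegrallyClosedIn S E M hSM t₀ ht₀M hMcl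
  refine ⟨t, ht₀t, htM, hMcl.trans (Subfield.closure_mono (Set.union_subset_union_right _ ht₀t)),
    ?_, hcl⟩
  -- `S[t₀] ⊆ O`, hence `t ⊆ O` by integral closedness of `O`, hence `S[t] ⊆ O`
  let OS : Subalgebra S E :=
    { OE.toSubring with
      algebraMap_mem' := fun s => hSO s }
  have hB : Algebra.adjoin S (t₀ : Set E) ≤ OS := Algebra.adjoin_le (fun x hx => ht₀O x hx)
  have hBO : ∀ b : Algebra.adjoin S (t₀ : Set E), (b : E) ∈ OE := fun b => hB b.2
  letI : Algebra (Algebra.adjoin S (t₀ : Set E)) OE :=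
    ((algebraMap (Algebra.adjoin S (t₀ : Set E)) E).codRestrict OE hBO).toAlgebra
  haveI : IsScalarTower (Algebra.adjoin S (t₀ : Set E)) OE E :=
    IsScalarTower.of_algebraMap_eq fun _ => rfl
  have htO : ∀ x ∈ t, x ∈ OE := by
    intro x hx
    have hx' : IsIntegral OE x := (htint x hx).tower_top
    obtain ⟨y, hy⟩ := (IsIntegrallyClosed.isIntegral_iff (R := OE) (K := E)).mp hx'
    rw [← hy]
    exact y.2
  change Algebra.adjoin S (t : Set E) ≤ OS
  exact Algebra.adjoin_le (fun x hx => htO x hx)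

end Literature.AlgebraicGeometry.Resolution

end

/-! ## The normal model of a finite separable extension above a normal model

[CoP1] Prop. 9.3 / Cossart–Piltant 2019 Def. 4.1: "Given a normal local model `B_P` of `𝒪_v|S`,
we define a normal local model `B′` of `𝒪_{v′}|S` by localizing the integral closure `B̄` of `B`
in `K′` … `B′` is actually a normal local model" — finiteness of the integral closure in a
finite SEPARABLE extension (Mathlib's `IsIntegralClosure.finite`). -/

namespace Literature.AlgebraicGeometry.Resolution

universe v

/-- **The model above a normal model** ("`R′` := the unique normal local model of `V′/k` lying
above `R`", HAL p. 27; Cossart–Piltant 2019 Def. 4.1). Let `S` be Noetherian, `S[t] ⊆ M ⊆ E`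
a normal model of the subfield `M` (generated by `t`, integrally closed in `M`), and `K′` a
finite separable extension of `M` inside `E`. Then there is a finite `t′ ⊆ K′` of elements
integral over `S[t]` such that `S[t ∪ t′]` is exactly the set of elements of `K′` integral over
`S[t]` — the integral closure of `S[t]` in `K′`, a finitely generated `S`-algebra.
[cite: CossartPiltant2019, Def. 4.1 (arXiv v1 p. 54)]
[cite: CossartPiltant2008, proof of Prop. 9.3 (HAL p. 27) "`R′` be the unique normal local model of `V′/k` lying above `R`"] -/
theorem exists_adjoin_eq_integralClosure_extension (S : Type v) [CommRing S] [IsNoetherianRing S]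
    (E : Type v) [Field E] [Algebra S E]
    (M : Subfield E) (hSM : ∀ s : S, algebraMap S E s ∈ M)
    (K' : IntermediateField M E) [FiniteDimensional M K'] [Algebra.IsSeparable M K']
    (t : Finset E) (htM : (t : Set E) ⊆ M)
    (hMcl : M ≤ Subfield.closure (Set.range (algebraMap S E) ∪ (t : Set E)))
    (hnorm : ∀ x : E, x ∈ M → IsIntegral (Algebra.adjoin S (t : Set E)) x →
      x ∈ Algebra.adjoin S (t : Set E)) :
    ∃ t' : Finset E, (t' : Set E) ⊆ (K' : Set E) ∧
      (∀ x ∈ Algebra.adjoin S ((t : Set E) ∪ (t' : Set E)),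
        IsIntegral (Algebra.adjoin S (t : Set E)) x) ∧
      ∀ x : E, x ∈ K' → IsIntegral (Algebra.adjoin S (t : Set E)) x →
        x ∈ Algebra.adjoin S ((t : Set E) ∪ (t' : Set E)) := by
  classical
  set B : Subalgebra S E := Algebra.adjoin S (t : Set E) with hBdef
  -- `B ⊆ M`
  let MS : Subalgebra S E :=
    { M.toSubring with
      algebraMap_mem' := fun s => hSM s }
  have hBM : ∀ b : B, (b : E) ∈ M := fun b =>
    (Algebra.adjoin_le (S := MS) htM : B ≤ MS) b.2
  haveI : Algebra.FiniteType S B :=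
    (Subalgebra.fg_iff_finiteType _).mp (Subalgebra.fg_adjoin_finset _)
  haveI : IsNoetherianRing B := Algebra.FiniteType.isNoetherianRing S B
  -- `K = M`, a fraction field of `B`
  let K : Type v := M
  letI : Algebra B K := ((algebraMap B E).codRestrict M hBM).toAlgebra
  haveI : IsScalarTower B K E := IsScalarTower.of_algebraMap_eq fun _ => rfl
  have hBinj : Function.Injective (algebraMap B K) := fun a b hab => by
    apply Subtype.ext
    have := congrArg (fun z : K => (z : E)) hab
    exact this
  haveI : FaithfulSMul B K := (faithfulSMul_iff_algebraMap_injective B K).mpr hBinj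
  have hcoeK : ∀ b : B, ((algebraMap B K b : K) : E) = (b : E) := fun _ => rfl
  haveI : IsFractionRing B K := by
    refine IsFractionRing.of_field B K fun z => ?_
    obtain ⟨a, b, ha, hb, -, hzab⟩ := exists_div_eq_of_mem_closure₀ (t : Set E) (hMcl z.2)
    refine ⟨⟨a, ha⟩, ⟨b, hb⟩, Subtype.ext ?_⟩
    change (z : E) = (((algebraMap B K ⟨a, ha⟩ / algebraMap B K ⟨b, hb⟩ : K) : E))
    rw [Subfield.coe_div, hcoeK, hcoeK]
    exact hzab
  -- `B` is integrally closed
  haveI : IsIntegrallyClosed B := by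
    refine (isIntegrallyClosed_iff K).mpr (fun {x} hx => ?_)
    have hxE : IsIntegral B (x : E) := hx.map (IsScalarTower.toAlgHom B K E)
    exact ⟨⟨(x : E), hnorm x x.2 hxE⟩, Subtype.ext rfl⟩
  -- `L = K'` over `K` and over `B`
  let L : Type v := K'
  -- `Algebra B L` is `IntermediateField.algebra'` (through `K = M`)
  haveI : IsScalarTower B K L := IsScalarTower.of_algebraMap_eq fun _ => rfl
  haveI : IsScalarTower B L E := IsScalarTower.of_algebraMap_eq fun _ => rfl
  -- the integral closure of `B` in `L` is a finite `B`-module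
  have hfin : Module.Finite B (integralClosure B L) := IsIntegralClosure.finite B K L _
  obtain ⟨s, hs⟩ :=
    (Module.Finite.iff_fg (N := Subalgebra.toSubmodule (integralClosure B L))).mp hfin
  let s' : Finset E := s.image (fun z : L => (z : E))
  have hs'int : ∀ x ∈ s', IsIntegral B x := by
    intro x hx
    obtain ⟨z, hz, rfl⟩ := Finset.mem_image.mp hx
    have hzC : z ∈ integralClosure B L := by
      have : z ∈ Subalgebra.toSubmodule (integralClosure B L) := by
        rw [← hs]; exact Submodule.subset_span hz
      exact this
    exact ((mem_integralClosure_iff B L).mp hzC).map (IsScalarTower.toAlgHom B L E)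
  have hBt : B ≤ Algebra.adjoin S ((t : Set E) ∪ (s' : Set E)) :=
    Algebra.adjoin_mono Set.subset_union_left
  have hadj : Algebra.adjoin S ((t : Set E) ∪ (s' : Set E)) =
      (Algebra.adjoin B (s' : Set E)).restrictScalars S := by
    rw [Algebra.adjoin_union_eq_adjoin_adjoin]
  haveI hint : Algebra.IsIntegral B (Algebra.adjoin B (s' : Set E)) :=
    Algebra.IsIntegral.adjoin (fun x hx => hs'int x hx)
  refine ⟨s', ?_, ?_, ?_⟩
  · -- `t' ⊆ K'`
    intro x hx
    obtain ⟨z, -, rfl⟩ := Finset.mem_image.mp hx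
    exact z.2
  · -- `S[t ∪ t']` is integral over `S[t]`
    intro y hy
    have hy' : y ∈ Algebra.adjoin B (s' : Set E) := by
      have h2 : y ∈ (Algebra.adjoin B (s' : Set E)).restrictScalars S := (le_of_eq hadj) hy
      exact h2
    exact (hint.isIntegral ⟨y, hy'⟩).map (Algebra.adjoin B (s' : Set E)).val
  · -- integral elements of `K'` lie in `S[t ∪ t']`
    intro x hxK' hxint
    have hxL : IsIntegral B (⟨x, hxK'⟩ : L) :=
      (isIntegral_algHom_iff (IsScalarTower.toAlgHom B L E) (fun a b h => Subtype.ext h)).mp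
        hxint
    have hxspan : (⟨x, hxK'⟩ : L) ∈ Submodule.span B (s : Set L) := by
      rw [hs]; exact hxL
    have key : ∀ z : L, z ∈ Submodule.span B (s : Set L) →
        (z : E) ∈ Algebra.adjoin S ((t : Set E) ∪ (s' : Set E)) := by
      intro z hz
      refine Submodule.span_induction ?_ ?_ ?_ ?_ hz
      · intro w hw
        exact Algebra.subset_adjoin
          (Or.inr (Finset.mem_coe.mpr (Finset.mem_image.mpr ⟨w, hw, rfl⟩)))
      · exact zero_mem _
      · intro a b _ _ ha hb
        exact add_mem ha hb
      · intro b w _ hw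
        change ((b : E) * (w : E)) ∈ _
        exact mul_mem (hBt b.2) hw
    exact key _ hxspan

end Literature.AlgebraicGeometry.Resolution

/-! ## The local ring of a normal model at the centre -/

namespace Literature.AlgebraicGeometry.Resolution

universe w

/-- **The local ring of a normal model at the centre is integrally closed.** For a subring `B`
of a field `E` with field of fractions the subfield `K` (every element of `K` is a quotient of
elements of `B`), integrally closed in `K`, and contained in a valuation ring `O`: the local ring
`B_{𝔪_O ∩ B} = locAtCentre B O` is an integrally closed domain (a localization of `B`).
[cite: CossartPiltant2019, Def. 4.1 (arXiv v1 p. 54) "normal local model"] -/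
theorem isIntegrallyClosed_locAtCentre {E : Type w} [Field E] (B : Subring E) (K : Subfield E)
    (hBK : B ≤ K.toSubring)
    (hK : ∀ z ∈ K, ∃ a ∈ B, ∃ b ∈ B, b ≠ 0 ∧ z = a / b)
    (hnorm : ∀ x ∈ K, IsIntegral B x → x ∈ B)
    (O : ValuationSubring E) (h : B ≤ O.toSubring) :
    IsIntegrallyClosed (locAtCentre B O) := by
  -- `K` as a fraction field of `B`
  let L : Type w := K
  letI : Algebra B L := ((B.subtype).codRestrict K (fun b => hBK b.2)).toAlgebra
  haveI : IsScalarTower B L E := IsScalarTower.of_algebraMap_eq fun _ => rfl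
  have hinj : Function.Injective (algebraMap B L) := fun a b hab => by
    apply Subtype.ext
    have := congrArg (fun z : L => (z : E)) hab
    exact this
  haveI : FaithfulSMul B L := (faithfulSMul_iff_algebraMap_injective B L).mpr hinj
  haveI : IsFractionRing B L := by
    refine IsFractionRing.of_field B L fun z => ?_
    obtain ⟨a, ha, b, hb, -, hz⟩ := hK z z.2
    exact ⟨⟨a, ha⟩, ⟨b, hb⟩, Subtype.ext hz⟩
  haveI : IsIntegrallyClosed B := by
    refine (isIntegrallyClosed_iff L).mpr (fun {x} hx => ?_)
    have hxE : IsIntegral B (x : E) := hx.map (IsScalarTower.toAlgHom B L E)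
    exact ⟨⟨(x : E), hnorm x x.2 hxE⟩, Subtype.ext rfl⟩
  exact isIntegrallyClosed_of_isLocalization (locAtCentre B O)
    (subringCentre B O h).primeCompl (Ideal.primeCompl_le_nonZeroDivisors _)

end Literature.AlgebraicGeometry.Resolution
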